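import Literature.AlgebraicGeometry.Motives.ChowTheoremProofs
import Literature.AlgebraicGeometry.Motives.GAGAConeVertexProofs
import HarnessLib

/-!
# Chow's theorem: the cone forms, the projective form and the vertex — proved equivalences

Companion to `Literature/AlgebraicGeometry/Motives/ChowTheorem.lean` and `…/GAGA.lean`, which
record Chow's theorem [Chow1949, Thm. V, p. 910: "A compact analytic variety in `Sₙ` is an
algebraic variety"] as several **named facts**:

* `exists_finset_isHomogeneous_of_isCone` — a closed cone in `ℂⁿ⁺¹`, analytic off the vertex, is
  cut out by finitely many homogeneous polynomials (cone form, homogeneous equations);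
* `exists_ideal_eq_zeroLocus_of_isCone` — the same with "zero locus of a polynomial ideal";
* `isAnalyticSet_conePreimage_iff` (`GAGA.lean`) — the affine cone `C(Z)` over `Z ⊆ ℙⁿ(ℂ)` is
  analytic in `ℂⁿ⁺¹` iff `Z` is analytic in `ℙⁿ(ℂ)`;
* `isProjAlgebraicSet_of_isAnalyticSet` (`GAGA.lean`) — every closed analytic subset of `ℙⁿ(ℂ)`
  is projective algebraic (the projective form).

Everything in this file is **proved**. Together with the landed
`tfae_cone_form_projective_form_conePreimage_iff` (`GAGAConeVertexProofs.lean`: the first, third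
and fourth statements are equivalent) we obtain that all four statements (for a fixed `n`) are
pairwise equivalent, and equivalent to the single analytic statement

* (`V`) *every closed cone in `ℂⁿ⁺¹` which is analytic off the vertex is analytic at the vertex*

(`exists_finset_isHomogeneous_of_isCone_iff_forall_isAnalyticSetAt_zero`), which is the special
case "cones, one puncture" of the Remmert–Stein extension theorem [Chirka1989, §4.4 Cor., p. 48;
used verbatim in the printed proof of Chow's theorem, §7.1 p. 74; Mumford, *Complex Projective
Varieties*, §4A (4.5)]. Thus the four named facts are *one* theorem, whose only unformalised
input is (`V`); and the elementary converse `IsProjAlgebraicSet.isAnalyticSet` (`GAGA.lean`) is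
discharged here.

## Contents

1. **Algebra of cones** [Mumford, *Complex Projective Varieties*, §4B; Griffiths–Harris,
   p. 167]: a polynomial vanishing on a cone has all its homogeneous components vanishing on it
   (`IsCone.eval_homogeneousComponent_eq_zero`, by `Polynomial.funext` on the complex line
   through a point of the cone); hence a cone which is the zero locus of an ideal is cut out by
   finitely many homogeneous polynomials (`IsCone.exists_finset_isHomogeneous_of_eq_zeroLocus`,
   Hilbert's basis theorem), and the two cone forms are equivalent
   (`exists_finset_isHomogeneous_of_isCone_iff`).
2. **The vertex** (H. Cartan's argument, landed in `ChowTheoremProofs.lean` as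
   `mem_iff_forall_apply_diag_eq_zero_of_isCone` / `exists_mvPolynomial_eval_eq_apply_diag`):
   a cone analytic *at* `0` is algebraic, with no closedness assumption
   (`IsCone.exists_ideal_eq_zeroLocus_of_isAnalyticSetAt_zero`,
   `IsCone.exists_finset_isHomogeneous_of_isAnalyticSetAt_zero`). [Chirka1989, §7.1 Remark]
3. **Reduction to the vertex**: cone form `↔` (`V`)
   (`exists_finset_isHomogeneous_of_isCone_iff_forall_isAnalyticSetAt_zero`).
4. **Discharge** of the elementary converse `IsProjAlgebraicSet.isAnalyticSet` (`GAGA.lean`):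
   projective algebraic sets are analytic (`IsProjAlgebraicSet.isAnalyticSet_holds`, from the
   landed `isAnalyticSet_setOf_forall_eval_eq_zero` and
   `isAnalyticSet_of_isAnalyticSet_conePreimage`), whence
   `isProjAlgebraicSet_iff_isAnalyticSet_of_cone_form`: "projective algebraic `↔` analytic" in
   `ℙⁿ(ℂ)` conditionally on the cone form alone.
5. **Summary TFAE** of the five forms (`tfae_chow_cone_ideal_projective_conePreimage_vertex`,
   with `exists_ideal_eq_zeroLocus_of_isCone_iff_isProjAlgebraicSet_of_isAnalyticSet`).

What is NOT here: a proof of (`V`) / of `exists_finset_isHomogeneous_of_isCone` itself — this is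
the Remmert–Stein theorem across the vertex and needs the local theory of analytic sets (local
parametrisation, dimension), absent from Mathlib at this pin.

## References

* W.-L. Chow, *On compact complex analytic varieties*, Amer. J. Math. 71 (1949) 893–914, Thm. V
  (p. 910). [Chow1949]
* E. M. Chirka, *Complex Analytic Sets* (1989), §7.1 (Chow's theorem, pp. 73–75), §4.4 Cor.
  (Remmert–Stein, p. 48). [Chirka1989]
* D. Mumford, *Algebraic Geometry I: Complex Projective Varieties*, §4A (4.5)–(4.6), §4B.
* P. Griffiths, J. Harris, *Principles of Algebraic Geometry*, Ch. 1 §3, p. 167.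
-/

noncomputable section

open scoped Manifold Topology LinearAlgebra.Projectivization
open Set Filter Projectivization
open Literature.Geometry.Kaehler (IsAnalyticSet IsAnalyticSetAt IsAnalyticSetOn)

namespace Literature.AlgebraicGeometry.Motives

section Hodge

variable {n : ℕ}

/-! ### 1. Algebra of cones -/

/-- If a polynomial `p` vanishes on a cone `Z ⊆ ℂⁿ⁺¹`, then so does each homogeneous component
`p_d` of `p`: for `z ∈ Z` the one-variable polynomial `c ↦ p (c • z) = ∑_d p_d(z) c^d` vanishes at
every `c ∈ ℂ`, an infinite field, so all its coefficients `p_d(z)` vanish (i.e. the ideal of a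
cone is homogeneous). [Mumford, *Complex Projective Varieties*, §4B; Griffiths–Harris, p. 167]
[folklore] -/
theorem IsCone.eval_homogeneousComponent_eq_zero {Z : Set (Fin (n + 1) → ℂ)} (hZ : IsCone Z)
    {p : MvPolynomial (Fin (n + 1)) ℂ} (hp : ∀ z ∈ Z, MvPolynomial.eval z p = 0) (d : ℕ)
    {z : Fin (n + 1) → ℂ} (hz : z ∈ Z) :
    MvPolynomial.eval z (MvPolynomial.homogeneousComponent d p) = 0 := by
  classical
  -- the one-variable polynomial `q (c) = p (c • z)`, written out coefficientwise
  set q : Polynomial ℂ := ∑ i ∈ Finset.range (p.totalDegree + 1),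
    Polynomial.C (MvPolynomial.eval z (MvPolynomial.homogeneousComponent i p)) *
      Polynomial.X ^ i with hq
  have hq_eval : ∀ c : ℂ, q.eval c = MvPolynomial.eval (c • z) p := fun c => by
    conv_rhs => rw [← MvPolynomial.sum_homogeneousComponent p, map_sum]
    simp only [hq, Polynomial.eval_finsetSum, Polynomial.eval_mul, Polynomial.eval_C,
      Polynomial.eval_pow, Polynomial.eval_X]
    refine Finset.sum_congr rfl fun i _ => ?_
    rw [eval_smul_of_isHomogeneous (MvPolynomial.homogeneousComponent_isHomogeneous i p),
      mul_comm]
  have hq0 : q = 0 := Polynomial.funext fun c => by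
    rw [hq_eval, Polynomial.eval_zero]
    exact hp _ (hZ c z hz)
  have hcoeff : ∀ i, q.coeff i = if i ∈ Finset.range (p.totalDegree + 1) then
      MvPolynomial.eval z (MvPolynomial.homogeneousComponent i p) else 0 := fun i => by
    simp only [hq, Polynomial.finsetSum_coeff, Polynomial.coeff_C_mul_X_pow]
    rw [Finset.sum_ite_eq]
  by_cases hd : d ∈ Finset.range (p.totalDegree + 1)
  · have := hcoeff d
    rwa [if_pos hd, hq0, Polynomial.coeff_zero, eq_comm] at this
  · rw [Finset.mem_range, not_lt, Nat.succ_le_iff] at hd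
    rw [MvPolynomial.homogeneousComponent_eq_zero d p hd, map_zero]

/-- A cone `Z ⊆ ℂⁿ⁺¹` which is the zero locus of a polynomial ideal `I` is cut out by finitely
many *homogeneous* polynomials: by Hilbert's basis theorem `I` is generated by finitely many
polynomials `g₁, …, g_k`; the (finitely many, homogeneous) homogeneous components of the `gⱼ`
still vanish on `Z` (`IsCone.eval_homogeneousComponent_eq_zero`), and a common zero of them is a
zero of every `gⱼ`, hence of `I`. [Mumford, *Complex Projective Varieties*, §4B;
Griffiths–Harris, p. 167] [folklore] -/
theorem IsCone.exists_finset_isHomogeneous_of_eq_zeroLocus {Z : Set (Fin (n + 1) → ℂ)}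
    (hZ : IsCone Z) {I : Ideal (MvPolynomial (Fin (n + 1)) ℂ)}
    (hZI : Z = MvPolynomial.zeroLocus ℂ I) :
    ∃ S : Finset (MvPolynomial (Fin (n + 1)) ℂ), (∀ p ∈ S, ∃ d, p.IsHomogeneous d) ∧
      Z = {z | ∀ p ∈ S, MvPolynomial.eval z p = 0} := by
  classical
  obtain ⟨G, hGI⟩ : I.FG := IsNoetherian.noetherian I
  rw [← hGI, MvPolynomial.zeroLocus_span] at hZI
  have hGZ : ∀ z, z ∈ Z ↔ ∀ g ∈ G, MvPolynomial.eval z g = 0 := fun z => by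
    rw [hZI]
    exact Iff.rfl
  refine ⟨G.biUnion fun g => (Finset.range (g.totalDegree + 1)).image
      fun d => MvPolynomial.homogeneousComponent d g, fun p hp => ?_, Set.ext fun z => ?_⟩
  · obtain ⟨g, -, hp⟩ := Finset.mem_biUnion.1 hp
    obtain ⟨d, -, rfl⟩ := Finset.mem_image.1 hp
    exact ⟨d, MvPolynomial.homogeneousComponent_isHomogeneous d g⟩
  · refine ⟨fun hz p hp => ?_, fun h => (hGZ z).2 fun g hg => ?_⟩
    · obtain ⟨g, hg, hp⟩ := Finset.mem_biUnion.1 hp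
      obtain ⟨d, -, rfl⟩ := Finset.mem_image.1 hp
      exact hZ.eval_homogeneousComponent_eq_zero (fun w hw => (hGZ w).1 hw g hg) d hz
    · rw [← MvPolynomial.sum_homogeneousComponent g, map_sum]
      refine Finset.sum_eq_zero fun d hd => h _ ?_
      exact Finset.mem_biUnion.2 ⟨g, hg, Finset.mem_image.2 ⟨d, hd, rfl⟩⟩

/-- The homogeneous-equations form of Chow's theorem (`exists_finset_isHomogeneous_of_isCone`)
follows from the ideal form (`exists_ideal_eq_zeroLocus_of_isCone`) by pure algebra
(`IsCone.exists_finset_isHomogeneous_of_eq_zeroLocus`). [folklore] -/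
theorem exists_finset_isHomogeneous_of_isCone_of_exists_ideal
    (h : exists_ideal_eq_zeroLocus_of_isCone (n := n)) :
    exists_finset_isHomogeneous_of_isCone (n := n) := by
  intro Z hZc hZ hZa
  obtain ⟨I, hI⟩ := h hZc hZ hZa
  exact hZ.exists_finset_isHomogeneous_of_eq_zeroLocus hI

/-- Conversely, the ideal form of Chow's theorem follows from the homogeneous-equations form:
take the ideal spanned by the equations (`MvPolynomial.zeroLocus_span`). [folklore] -/
theorem exists_ideal_eq_zeroLocus_of_isCone_of_exists_finset
    (h : exists_finset_isHomogeneous_of_isCone (n := n)) :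
    exists_ideal_eq_zeroLocus_of_isCone (n := n) := by
  intro Z hZc hZ hZa
  obtain ⟨S, -, hS⟩ := h hZc hZ hZa
  refine ⟨Ideal.span (S : Set (MvPolynomial (Fin (n + 1)) ℂ)), ?_⟩
  rw [MvPolynomial.zeroLocus_span, hS]
  exact Set.ext fun z => Iff.rfl

/-- **The two cone forms of Chow's theorem are equivalent** (`ChowTheorem.lean`: finitely many
homogeneous equations, resp. a polynomial ideal), by pure algebra. [folklore] -/
theorem exists_finset_isHomogeneous_of_isCone_iff :
    exists_finset_isHomogeneous_of_isCone (n := n) ↔ exists_ideal_eq_zeroLocus_of_isCone (n := n) :=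
  ⟨exists_ideal_eq_zeroLocus_of_isCone_of_exists_finset,
    exists_finset_isHomogeneous_of_isCone_of_exists_ideal⟩

/-! ### 2. The vertex -/

/-- **Chow's theorem at the vertex** (H. Cartan's argument): a cone `Z ⊆ ℂⁿ⁺¹` which is analytic
*at the vertex* `0` is the zero locus of a polynomial ideal — generated by the homogeneous
polynomials `z ↦ p_d(z, …, z)ⱼ` attached to a power series `p` of the local equations at `0`
(`mem_iff_forall_apply_diag_eq_zero_of_isCone`, `exists_mvPolynomial_eval_eq_apply_diag`). No
closedness assumption and no analyticity elsewhere is needed.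
[Mumford, *Complex Projective Varieties*, §4B] [cite: Chirka1989, §7.1, Remark after the Theorem] -/
theorem IsCone.exists_ideal_eq_zeroLocus_of_isAnalyticSetAt_zero {Z : Set (Fin (n + 1) → ℂ)}
    (hZ : IsCone Z) (h0 : IsAnalyticSetAt 𝓘(ℂ, Fin (n + 1) → ℂ) Z 0) :
    ∃ I : Ideal (MvPolynomial (Fin (n + 1)) ℂ), Z = MvPolynomial.zeroLocus ℂ I := by
  obtain ⟨U, hUo, h0U, m, f, hf, hZU⟩ := h0
  obtain ⟨p, hp⟩ : AnalyticAt ℂ f 0 :=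
    Literature.Analysis.Complex.SCV.analyticAt_of_differentiableOn hf.differentiableOn hUo h0U
  have key := mem_iff_forall_apply_diag_eq_zero_of_isCone hZ (hUo.mem_nhds h0U) hZU hp
  -- homogeneous polynomials `Q (d, j)` with `Q (d, j) (z) = p_d(z, …, z)ⱼ`
  choose Q _hQ hQ using fun dj : ℕ × Fin m => exists_mvPolynomial_eval_eq_apply_diag
    ((ContinuousLinearMap.proj dj.2 : (Fin m → ℂ) →L[ℂ] ℂ).compContinuousMultilinearMap (p dj.1))
  refine ⟨Ideal.span (Set.range Q), Set.ext fun z => ?_⟩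
  rw [MvPolynomial.zeroLocus_span, key z]
  simp only [mem_setOf_eq, forall_mem_range, Prod.forall, MvPolynomial.aeval_eq_eval, hQ,
    ContinuousLinearMap.compContinuousMultilinearMap_coe, Function.comp_apply,
    ContinuousLinearMap.proj_apply, funext_iff, Pi.zero_apply]

/-- **Chow's theorem at the vertex, homogeneous equations**: a cone `Z ⊆ ℂⁿ⁺¹` analytic at the
vertex `0` is cut out by finitely many homogeneous polynomials
(`IsCone.exists_ideal_eq_zeroLocus_of_isAnalyticSetAt_zero` and Hilbert's basis theorem via
`IsCone.exists_finset_isHomogeneous_of_eq_zeroLocus`).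
[Mumford, *Complex Projective Varieties*, §4B] [cite: Chirka1989, §7.1, Remark after the Theorem] -/
theorem IsCone.exists_finset_isHomogeneous_of_isAnalyticSetAt_zero {Z : Set (Fin (n + 1) → ℂ)}
    (hZ : IsCone Z) (h0 : IsAnalyticSetAt 𝓘(ℂ, Fin (n + 1) → ℂ) Z 0) :
    ∃ S : Finset (MvPolynomial (Fin (n + 1)) ℂ), (∀ p ∈ S, ∃ d, p.IsHomogeneous d) ∧
      Z = {z | ∀ p ∈ S, MvPolynomial.eval z p = 0} := by
  obtain ⟨I, hI⟩ := hZ.exists_ideal_eq_zeroLocus_of_isAnalyticSetAt_zero h0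
  exact hZ.exists_finset_isHomogeneous_of_eq_zeroLocus hI

/-! ### 3. Reduction of the cone form to analyticity at the vertex -/

/-- **Chow's theorem (cone form) `↔` analyticity of cones at the vertex.** The named fact
`exists_finset_isHomogeneous_of_isCone` holds in dimension `n + 1` iff every closed cone in
`ℂⁿ⁺¹` which is analytic off the vertex is analytic *at* the vertex (the Remmert–Stein step of
the printed proofs, [Chirka1989, §7.1 p. 74 with §4.4 Cor.]; Mumford (4.5)). `←` is the vertex
theorem `IsCone.exists_finset_isHomogeneous_of_isAnalyticSetAt_zero`; `→` holds because common
zero sets of finitely many polynomials are analytic (`isAnalyticSet_setOf_forall_eval_eq_zero`).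
[cite: Chirka1989, §7.1, proof of the Theorem, p. 74] -/
theorem exists_finset_isHomogeneous_of_isCone_iff_forall_isAnalyticSetAt_zero :
    exists_finset_isHomogeneous_of_isCone (n := n) ↔
      ∀ Z : Set (Fin (n + 1) → ℂ), IsClosed Z → IsCone Z →
        IsAnalyticSetOn 𝓘(ℂ, Fin (n + 1) → ℂ) Z {0}ᶜ → IsAnalyticSetAt 𝓘(ℂ, Fin (n + 1) → ℂ) Z 0 := by
  refine ⟨fun h Z hZc hZ hZa => ?_, fun h Z hZc hZ hZa => ?_⟩
  · obtain ⟨S, -, hS⟩ := h hZc hZ hZa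
    rw [hS]
    exact isAnalyticSet_setOf_forall_eval_eq_zero S 0
  · exact hZ.exists_finset_isHomogeneous_of_isAnalyticSetAt_zero (h Z hZc hZ hZa)

/-! ### 4. The converse of Chow's theorem (`GAGA.lean`) and the conditional `iff`

(The ideal cone form joins the landed `tfae_cone_form_projective_form_conePreimage_iff` of
`GAGAConeVertexProofs.lean` through `exists_finset_isHomogeneous_of_isCone_iff`; see §5.) -/

/-- **Discharge of the named fact `IsProjAlgebraicSet.isAnalyticSet`** (`GAGA.lean`; the
elementary converse of Chow's theorem): a projective algebraic set `Z = V(S) ⊆ ℙⁿ(ℂ)` is an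
analytic subset of `ℙⁿ(ℂ)`. Indeed its affine cone `C(Z)` is the common zero set of finitely many
(homogeneous) polynomials (`isProjAlgebraicSet_iff_isCone_preimage`), hence analytic in `ℂⁿ⁺¹`
(`isAnalyticSet_setOf_forall_eval_eq_zero`), and analyticity of the cone descends to `ℙⁿ(ℂ)`
(`isAnalyticSet_of_isAnalyticSet_conePreimage`). Declared with its absolute name in the namespace
of the fact (`Literature.NumberTheory.Transcendental`, file `GAGA.lean`), as `<fact>_holds`.
[Griffiths–Harris, p. 166; Chirka §7.1, p. 73] [cite: GriffithsHarris1978, p. 166] -/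
theorem _root_.Literature.NumberTheory.Transcendental.IsProjAlgebraicSet.isAnalyticSet_holds :
    Literature.NumberTheory.Transcendental.IsProjAlgebraicSet.isAnalyticSet (n := n) := by
  intro Z hZ
  obtain ⟨S, -, hSZ⟩ := isProjAlgebraicSet_iff_isCone_preimage.1 hZ
  refine isAnalyticSet_of_isAnalyticSet_conePreimage ?_
  rw [hSZ]
  exact isAnalyticSet_setOf_forall_eval_eq_zero S

/-- **Projective algebraic `↔` analytic, under the cone form of Chow's theorem.** With the
converse now proved (`IsProjAlgebraicSet.isAnalyticSet_holds`) and the bridge proved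
(`isAnalyticSetOn_conePreimage_iff_holds`), a subset of `ℙⁿ(ℂ)` is projective algebraic iff it is
a (closed) analytic subset, conditionally only on the single named fact
`exists_finset_isHomogeneous_of_isCone`. [Serre, GAGA (1956), §3 Prop. 13; Griffiths–Harris,
p. 167] [cite: Chow1949, Thm. V] -/
theorem isProjAlgebraicSet_iff_isAnalyticSet_of_cone_form
    (cone_form : exists_finset_isHomogeneous_of_isCone (n := n)) {Z : Set (ℙ ℂ (Fin (n + 1) → ℂ))} :
    Literature.NumberTheory.Transcendental.IsProjAlgebraicSet Z ↔ IsAnalyticSet 𝓘(ℂ, Fin n → ℂ) Z :=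
  isProjAlgebraicSet_iff_isAnalyticSet (isProjAlgebraicSet_of_isAnalyticSet_of_cone_form' cone_form)
    Literature.NumberTheory.Transcendental.IsProjAlgebraicSet.isAnalyticSet_holds

/-- The ideal form `exists_ideal_eq_zeroLocus_of_isCone` implies the corollary
`exists_ideal_eq_zeroLocus_of_isAnalyticSet_of_isCone` (the interim proof recorded as a comment
in `ChowTheorem.lean`, restored as a reduction; the corollary itself is proved outright in
`ChowTheoremProofs.lean`). [folklore] -/
theorem exists_ideal_eq_zeroLocus_of_isAnalyticSet_of_isCone_of
    (h : exists_ideal_eq_zeroLocus_of_isCone (n := n)) :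
    exists_ideal_eq_zeroLocus_of_isAnalyticSet_of_isCone (n := n) :=
  fun hZ hc => h hZ.isClosed hc ((hZ.isAnalyticSetOn univ).mono (subset_univ _))

/-! ### 5. Summary: the five forms of Chow's theorem are equivalent -/

/-- **The ideal cone form joins the TFAE**: `exists_ideal_eq_zeroLocus_of_isCone` is equivalent
to the projective form `isProjAlgebraicSet_of_isAnalyticSet` of Chow's theorem (through
`exists_finset_isHomogeneous_of_isCone_iff` and the landed
`tfae_cone_form_projective_form_conePreimage_iff`). [cite: Chirka1989, §7.1, pp. 73–75] -/
theorem exists_ideal_eq_zeroLocus_of_isCone_iff_isProjAlgebraicSet_of_isAnalyticSet :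
    exists_ideal_eq_zeroLocus_of_isCone (n := n) ↔ isProjAlgebraicSet_of_isAnalyticSet (n := n) :=
  exists_finset_isHomogeneous_of_isCone_iff.symm.trans
    ((tfae_cone_form_projective_form_conePreimage_iff (n := n)).out 0 1)

/-- **The five forms of Chow's theorem (hodge.S17) at a fixed `n` are equivalent**: (1) the cone
form with finitely many homogeneous equations `exists_finset_isHomogeneous_of_isCone`, (2) the
cone form with a polynomial ideal `exists_ideal_eq_zeroLocus_of_isCone`, (3) the projective form
`isProjAlgebraicSet_of_isAnalyticSet`, (4) analyticity of affine cones over analytic subsets of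
`ℙⁿ(ℂ)` `isAnalyticSet_conePreimage_iff` — four named facts — and (5) the Remmert–Stein step
"a closed cone in `ℂⁿ⁺¹` analytic off the vertex is analytic at the vertex". Assembled from
`exists_finset_isHomogeneous_of_isCone_iff`, the landed
`tfae_cone_form_projective_form_conePreimage_iff` and
`exists_finset_isHomogeneous_of_isCone_iff_forall_isAnalyticSetAt_zero`. The common unformalised
content is the Remmert–Stein theorem [Chirka1989, §4.4 Cor., p. 48].
[cite: Chirka1989, §7.1, pp. 73–75] -/
theorem tfae_chow_cone_ideal_projective_conePreimage_vertex :
    [exists_finset_isHomogeneous_of_isCone (n := n), exists_ideal_eq_zeroLocus_of_isCone (n := n),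
      isProjAlgebraicSet_of_isAnalyticSet (n := n), isAnalyticSet_conePreimage_iff (n := n),
      ∀ Z : Set (Fin (n + 1) → ℂ), IsClosed Z → IsCone Z →
        IsAnalyticSetOn 𝓘(ℂ, Fin (n + 1) → ℂ) Z {0}ᶜ →
          IsAnalyticSetAt 𝓘(ℂ, Fin (n + 1) → ℂ) Z 0].TFAE := by
  have h3 := tfae_cone_form_projective_form_conePreimage_iff (n := n)
  tfae_have 1 ↔ 2 := exists_finset_isHomogeneous_of_isCone_iff
  tfae_have 1 ↔ 3 := h3.out 0 1
  tfae_have 1 ↔ 4 := h3.out 0 2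
  tfae_have 1 ↔ 5 := exists_finset_isHomogeneous_of_isCone_iff_forall_isAnalyticSetAt_zero
  tfae_finish

end Hodge

end Literature.AlgebraicGeometry.Motives

end
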